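import Mathlib
import Summits.NavierStokesRegularity.NavierStokesRegularity.Theorems.TaoLadderRungTwoFlatCertificateGlueExistOn
import Summits.NavierStokesRegularity.NavierStokesRegularity.Theorems.TaoLadderRungTwoFlatHopTubeWith
import HarnessLib

/-!
# THE EXISTENCE CLAUSE `TubeExistWith` OF THE TUBE FRAME REDUCED TO AN A-PRIORI BOUND (K4, first step): exact flows on the whole clock
  window `[0, c]` from every ball state exist as soon as every exact flow from that state on `[0, s] ⊆ [0, c]` is bounded a priori in an
  admissible weighted sup norm
  (helper for the K_A♭ parent item stmt-NavierStokesRegularity-22987 `FlatGapCertificatesV2`, child 2A `GradedAdiabaticWakeA` of route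
  TaoLadderRungTwoFlat; cell harvest/h2-tao-ladder, p1 g25; LADDER §47.5 L2, §50 (`TubeExist`, K4))

`HopTube.gapData₂On_of_tubeWith` / `gapData₂On_of_phases` take the format's (exist₀) clause for the described set as `TubeExistWith`:
from every state `S₀` of the weighted `r`-ball around the tube an EXACT graded flow exists on `[0, c]`. The continuation criterion of
`Literature…WeightedLatticeFlowsOn` (`exists_exact_pseudoFlowOnShift_of_apriori_bound`: Picard–Lindelöf + continuation in the Banach space
`Fin m × ℤ →ᵇ ℝ` of conjugated states `T = ω·S`) reduces this to an a-priori bound for conjugated solutions; reading a conjugated solution as an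
exact `PseudoFlowOnShift` on `[0, s]` (`CertificateGlueOn.pseudoFlowOnShift_of_conjugated`) turns that into the statement the in-hop loops
speak about: **every exact flow from `S₀` on `[0, s] ⊆ [0, c]` obeys `ω_k|S_{ik}(t)| ≤ B(S₀)`**, for an admissible weight `ω`
(`WeightRatiosLEOn 𝕊 ε₀ ω A`, `(1+(1+ε₀)^{10k})/ω_k ≤ D`).

* `tubeExistWith_of_apriori` — `TubeExistWith P Bcl 𝕊 ε₀ i₀ α X₀ w r ζ u⋆ c` from that a-priori bound, hop by hop and state by state.

HONEST FRAMING: a reduction (soft analysis over the Literature continuation criterion) for MODEL-lattice flows; the a-priori bound on the whole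
clock window is the HYPOTHESIS that remains (K4 proper); nothing certified; no item closed; nothing about the Navier–Stokes equations.
-/

noncomputable section

-- the sub-problem namespace repeats the summit name by design (D-0017)
set_option linter.dupNamespace false

namespace Summit.NavierStokesRegularity.NavierStokesRegularity.Theorems.HopTube

open Set Filter BoundedContinuousFunction Literature.Analysis.FluidPDE Literature.Analysis.FluidPDE.TaoCascade CertificateGlueOn

/-- **`TubeExistWith` FROM AN A-PRIORI WEIGHTED BOUND ON THE CLOCK WINDOW.** For an admissible Banach-space weight `ω` and a table bounded by
`M_α`: if for every hop `n`, tube state `z` and ball state `S₀` there is `B` with `ω_k|S₀| ≤ B` and `ω_k|S_{ik}(t)| ≤ B` along EVERY exact flow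
from `S₀` on every `[0, s] ⊆ [0, c]`, then the exact flow from every ball state exists on `[0, c]`.
[cite: Tao2016AveragedNS, §4 Lemma 4.1 (4.5), (4.8)–(4.10) with (4.12); Teschl2012, Cor. 2.16; route TaoLadderRungTwoFlat, `HopTube.TubeExistWith` (cell LADDER §47.5 L2, K4)] -/
theorem tubeExistWith_of_apriori (P : TubeSchedule) {Bcl : ℕ → (Fin 2 → ℤ → ℝ) → Prop} {𝕊 : Finset (ℤ × ℤ × ℤ)}
    {ε₀ A Mα Dω c : ℝ} {i₀ : Fin 2} {α : Fin 2 → Fin 2 → Fin 2 → ℤ × ℤ × ℤ → ℝ} {X₀ : Fin 2 → ℝ} {w : ℤ → ℝ} {r : ℝ}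
    {ζ : ℕ → Fin 2 → ℤ → ℝ} {ustar : Fin 2 → ℤ → ℝ} {ω : ℤ → ℝ}
    (hε : 0 ≤ 1 + ε₀) (hω : WeightRatiosLEOn 𝕊 ε₀ ω A) (hA : 0 ≤ A) (hMα : 0 ≤ Mα)
    (hα : ∀ i₁ i₂ i₃ μ, |α i₁ i₂ i₃ μ| ≤ Mα) (hD : ∀ k : ℤ, (1 + (1 + ε₀) ^ ((10 : ℝ) * k)) / ω k ≤ Dω) (hc : 0 < c)
    (hapr : ∀ (n : ℕ) (z S₀ : Fin 2 → ℤ → ℝ), InTubeWith P Bcl i₀ X₀ w r ζ ustar n z →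
      (∀ i k, w k * |S₀ i k - z i k| ≤ r) →
        ∃ B : ℝ, (∀ i k, ω k * |S₀ i k| ≤ B) ∧
          ∀ s : ℝ, 0 < s → s ≤ c → ∀ S F : Fin 2 → ℤ → ℝ → ℝ,
            PseudoFlowOnShift 𝕊 s ε₀ α 0 0 S₀ (fun i k => (1 / 2) * S₀ i k ^ 2) (fun _ _ => 0) S F →
              ∀ t ∈ Icc 0 s, ∀ (i : Fin 2) (k : ℤ), ω k * |S i k t| ≤ B) :
    TubeExistWith P Bcl 𝕊 ε₀ i₀ α X₀ w r ζ ustar c := by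
  intro S₀ hball
  obtain ⟨z, ⟨n, hz⟩, hkick⟩ := hball
  obtain ⟨B, hB₀, hB⟩ := hapr n z S₀ hz hkick
  have hωpos : ∀ k, 0 < ω k := hω.1
  have hBnn : 0 ≤ B := le_trans (mul_nonneg (hωpos 0).le (abs_nonneg _)) (hB₀ 0 0)
  obtain ⟨T₀, hT₀, hT₀B⟩ := exists_weightedState hBnn S₀ hB₀ hωpos
  obtain ⟨S, hS, -⟩ := exists_exact_pseudoFlowOnShift_of_apriori_bound hε hω hMα hα hA hD hc S₀ T₀ hT₀ hT₀B
    (fun s hs T hT0 hT t ht => by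
      rcases eq_or_lt_of_le hs.1 with h0 | hspos
      · have ht0 : t = 0 := le_antisymm (h0 ▸ ht.2) ht.1
        subst ht0
        rw [hT0]; exact hT₀B
      · have hstart : ∀ (i : Fin 2) (k : ℤ), T 0 (i, k) = ω k * S₀ i k := fun i k => by rw [hT0]; exact hT₀ i k
        have hflow := pseudoFlowOnShift_of_conjugated hε hω hMα hα hD hspos S₀ hstart hT
        have hb := hB s hspos hs.2 _ _ hflow t ht
        refine (norm_le hBnn).2 fun p => ?_
        have h := hb p.1 p.2
        rw [abs_div, abs_of_pos (hωpos p.2), mul_div_cancel₀ _ (hωpos p.2).ne'] at h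
        rw [Real.norm_eq_abs]
        exact h)
  exact ⟨S, _, hS⟩

end Summit.NavierStokesRegularity.NavierStokesRegularity.Theorems.HopTube

end
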